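import Summits.CriticalPhenomena.PercolationContinuityZ3.Theorems.Transplant.FKConnectivityAllQPat3Cone
import Summits.CriticalPhenomena.PercolationContinuityZ3.Theorems.Transplant.FKConnectivityAllQAntipodalUpc
import HarnessLib

/-!
# Connectivity correlation inequalities for `φ_{w,q}`, every `q > 0` — THE SYMMETRISED PRODUCT-CONE LEMMA for three-piece gluings
# (Stage S2, part 2c): certificates that dominate the target only on flip orbits of pattern cells

Definitions + theorems file (`--supports stmt-CriticalPhenomena-4575`), census lane `prim-bschramm-census` (gen 36) of the post-continuity programme (LANE 2 bschramm, FK sub-lane);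
builds on p205010 (kernel theorem, internal audit signed; external expert review pending).
No named facts, no sorries; standard axioms.  WHY: census g34's product-cone certificates (THETA_TS / THETA_STAR / RING_TS /
RING_STAR) live on the `15³` FLIP ORBITS of pattern pairs (each piece's pair `(P_p, Q_p)` taken unordered; LP rows = `3375 ×`
levels), i.e. they establish `Σ_{g ∈ (ℤ/2)³} (D τ_T − Σ_j λ_j π_j)(g · cell) ≥ 0`, NOT the cellwise domination of
`FK.cone3_level_nonneg` (file `…Pat3Cone.lean`), which on ordered cells would demand domination by the orbit MINIMUM of the target.
The symmetrised form is sound because flipping one piece (`γ_p ↦ E_p ∖ γ_p`) keeps the piece's level (`FK.apExp_compl`) and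
exchanges its two patterns, so the trilinear decomposition `FK.lev2_decomp3` can be re-indexed flip by flip:
* `FK.sum_powerset_flip3`; `FK.tripleSum` (the configuration-triple sum of a term in the levels and the six patterns) with
  `_flipK/_flip1/_flip2`, `_add`, `_const_mul`, `_finset_sum`, `_mono`, `_nonneg`; `FK.symm8` / **`FK.tripleSum_symm8`**
  (`8 · tripleSum X = tripleSum (symm8 X)`);
* `FK.target3Sym` (the target tensor summed over the flip orbit) / `FK.target3Sym_eq_zero_of_le`; `FK.xterm` / `FK.bterm` (the
  target- and product-side terms of the decomposition) with `_eq_target3` / `_eq_tensor` / `_eq_zero`;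
  `FK.tripleSum_bterm_nonneg` (the product side regrouped piece by piece with `FK.regroup1` is `≥ 0`);
* **`FK.cone3_level_nonneg_sym`** — hypotheses as `FK.cone3_level_nonneg` except
  `hcert : 8 · Σ_j λ_j π_j(d; cell) ≤ D · target3Sym(d; cell)`; conclusion `0 ≤ D · lev2 G b s t T λ` at every level.
[cite: AyyerLinussonRavichandran2025, §7 eq. (13)–(15) (p. 22)] [cite: Grimmett2006, §3.8 (pp. 61–62)]
-/

noncomputable section

namespace Summit.CriticalPhenomena.PercolationContinuityZ3.Theorems

namespace FK

open SimpleGraph Literature.Probability.LatticeModels Literature.Probability.Percolation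

/-! ### The symmetrised product-cone lemma (census g36)

Census g34's certificates dominate the target only after symmetrising over the eight piecewise flips `γ_p ↦ E_p ∖ γ_p`
(its LP lives on `15³` flip-orbits of pattern pairs, not on the `25³` ordered cells).  Each flip keeps the piece's level
(`FK.apExp_compl`) and exchanges the piece's two patterns, so the trilinear decomposition of the composite value can be
re-indexed flip by flip; summing the eight re-indexed copies replaces the target tensor by `FK.target3Sym` (the sum over the
orbit) while the (flip-invariant) product side is counted eight times. -/

section SymCone

open scoped Classical

variable {V : Type*}

/-- Flipping one piece inside a configuration sum: the level is kept, the two patterns are exchanged. [folklore] -/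
theorem sum_powerset_flip3 (E : Finset (Sym2 V)) (x y s : V) (F : ℕ → Pat3 → Pat3 → ℤ) :
    ∑ γ ∈ E.powerset, F (apExp E γ) (pat3 γ x y s) (pat3 (E \ γ) x y s) =
      ∑ γ ∈ E.powerset, F (apExp E γ) (pat3 (E \ γ) x y s) (pat3 γ x y s) := by
  rw [sum_powerset_flip E (fun γ => F (apExp E γ) (pat3 (E \ γ) x y s) (pat3 γ x y s))]
  refine Finset.sum_congr rfl fun γ hγ => ?_
  have h := Finset.mem_powerset.1 hγ
  rw [apExp_compl h, Finset.sdiff_sdiff_eq_self h]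

/-- The sum over configuration triples of the three pieces of a term depending on the levels and the pattern pairs. [folklore] -/
def tripleSum (EK E₁ E₂ : Finset (Sym2 V)) (uK vK mK u₁ v₁ m₁ u₂ v₂ m₂ : V)
    (X : ℕ → ℕ → ℕ → Pat3 → Pat3 → Pat3 → Pat3 → Pat3 → Pat3 → ℤ) : ℤ :=
  ∑ γK ∈ EK.powerset, ∑ γ₁ ∈ E₁.powerset, ∑ γ₂ ∈ E₂.powerset,
    X (apExp EK γK) (apExp E₁ γ₁) (apExp E₂ γ₂) (pat3 γK uK vK mK) (pat3 (EK \ γK) uK vK mK)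
      (pat3 γ₁ u₁ v₁ m₁) (pat3 (E₁ \ γ₁) u₁ v₁ m₁) (pat3 γ₂ u₂ v₂ m₂) (pat3 (E₂ \ γ₂) u₂ v₂ m₂)

variable (EK E₁ E₂ : Finset (Sym2 V)) (uK vK mK u₁ v₁ m₁ u₂ v₂ m₂ : V)

/-- Flip of the first piece inside a triple sum. [folklore] -/
theorem tripleSum_flipK (X : ℕ → ℕ → ℕ → Pat3 → Pat3 → Pat3 → Pat3 → Pat3 → Pat3 → ℤ) :
    tripleSum EK E₁ E₂ uK vK mK u₁ v₁ m₁ u₂ v₂ m₂ X =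
      tripleSum EK E₁ E₂ uK vK mK u₁ v₁ m₁ u₂ v₂ m₂ (fun eK e1 e2 PK QK P1 Q1 P2 Q2 => X eK e1 e2 QK PK P1 Q1 P2 Q2) := by
  unfold tripleSum
  exact sum_powerset_flip3 EK uK vK mK (fun eK PK QK => ∑ γ₁ ∈ E₁.powerset, ∑ γ₂ ∈ E₂.powerset,
    X eK (apExp E₁ γ₁) (apExp E₂ γ₂) PK QK (pat3 γ₁ u₁ v₁ m₁) (pat3 (E₁ \ γ₁) u₁ v₁ m₁) (pat3 γ₂ u₂ v₂ m₂)
      (pat3 (E₂ \ γ₂) u₂ v₂ m₂))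

/-- Flip of the second piece inside a triple sum. [folklore] -/
theorem tripleSum_flip1 (X : ℕ → ℕ → ℕ → Pat3 → Pat3 → Pat3 → Pat3 → Pat3 → Pat3 → ℤ) :
    tripleSum EK E₁ E₂ uK vK mK u₁ v₁ m₁ u₂ v₂ m₂ X =
      tripleSum EK E₁ E₂ uK vK mK u₁ v₁ m₁ u₂ v₂ m₂ (fun eK e1 e2 PK QK P1 Q1 P2 Q2 => X eK e1 e2 PK QK Q1 P1 P2 Q2) := by
  unfold tripleSum
  refine Finset.sum_congr rfl fun γK _ => ?_
  exact sum_powerset_flip3 E₁ u₁ v₁ m₁ (fun e1 P1 Q1 => ∑ γ₂ ∈ E₂.powerset,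
    X (apExp EK γK) e1 (apExp E₂ γ₂) (pat3 γK uK vK mK) (pat3 (EK \ γK) uK vK mK) P1 Q1 (pat3 γ₂ u₂ v₂ m₂)
      (pat3 (E₂ \ γ₂) u₂ v₂ m₂))

/-- Flip of the third piece inside a triple sum. [folklore] -/
theorem tripleSum_flip2 (X : ℕ → ℕ → ℕ → Pat3 → Pat3 → Pat3 → Pat3 → Pat3 → Pat3 → ℤ) :
    tripleSum EK E₁ E₂ uK vK mK u₁ v₁ m₁ u₂ v₂ m₂ X =
      tripleSum EK E₁ E₂ uK vK mK u₁ v₁ m₁ u₂ v₂ m₂ (fun eK e1 e2 PK QK P1 Q1 P2 Q2 => X eK e1 e2 PK QK P1 Q1 Q2 P2) := by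
  unfold tripleSum
  refine Finset.sum_congr rfl fun γK _ => Finset.sum_congr rfl fun γ₁ _ => ?_
  exact sum_powerset_flip3 E₂ u₂ v₂ m₂ (fun e2 P2 Q2 =>
    X (apExp EK γK) (apExp E₁ γ₁) e2 (pat3 γK uK vK mK) (pat3 (EK \ γK) uK vK mK) (pat3 γ₁ u₁ v₁ m₁)
      (pat3 (E₁ \ γ₁) u₁ v₁ m₁) P2 Q2)

/-- Additivity of the triple sum. [folklore] -/
theorem tripleSum_add (X X' : ℕ → ℕ → ℕ → Pat3 → Pat3 → Pat3 → Pat3 → Pat3 → Pat3 → ℤ) :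
    tripleSum EK E₁ E₂ uK vK mK u₁ v₁ m₁ u₂ v₂ m₂
        (fun eK e1 e2 PK QK P1 Q1 P2 Q2 => X eK e1 e2 PK QK P1 Q1 P2 Q2 + X' eK e1 e2 PK QK P1 Q1 P2 Q2) =
      tripleSum EK E₁ E₂ uK vK mK u₁ v₁ m₁ u₂ v₂ m₂ X + tripleSum EK E₁ E₂ uK vK mK u₁ v₁ m₁ u₂ v₂ m₂ X' := by
  unfold tripleSum
  simp only [Finset.sum_add_distrib]

/-- Homogeneity of the triple sum. [folklore] -/
theorem tripleSum_const_mul (c : ℤ) (X : ℕ → ℕ → ℕ → Pat3 → Pat3 → Pat3 → Pat3 → Pat3 → Pat3 → ℤ) :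
    tripleSum EK E₁ E₂ uK vK mK u₁ v₁ m₁ u₂ v₂ m₂ (fun eK e1 e2 PK QK P1 Q1 P2 Q2 => c * X eK e1 e2 PK QK P1 Q1 P2 Q2) =
      c * tripleSum EK E₁ E₂ uK vK mK u₁ v₁ m₁ u₂ v₂ m₂ X := by
  unfold tripleSum
  simp only [Finset.mul_sum]

/-- The triple sum commutes with finite sums of terms. [folklore] -/
theorem tripleSum_finset_sum {ι : Type*} (J : Finset ι) (X : ι → ℕ → ℕ → ℕ → Pat3 → Pat3 → Pat3 → Pat3 → Pat3 → Pat3 → ℤ) :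
    tripleSum EK E₁ E₂ uK vK mK u₁ v₁ m₁ u₂ v₂ m₂ (fun eK e1 e2 PK QK P1 Q1 P2 Q2 => ∑ j ∈ J, X j eK e1 e2 PK QK P1 Q1 P2 Q2) =
      ∑ j ∈ J, tripleSum EK E₁ E₂ uK vK mK u₁ v₁ m₁ u₂ v₂ m₂ (X j) := by
  unfold tripleSum
  symm
  rw [Finset.sum_comm]
  refine Finset.sum_congr rfl fun γK _ => ?_
  rw [Finset.sum_comm]
  refine Finset.sum_congr rfl fun γ₁ _ => ?_
  rw [Finset.sum_comm]

/-- Monotonicity of the triple sum. [folklore] -/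
theorem tripleSum_mono {X X' : ℕ → ℕ → ℕ → Pat3 → Pat3 → Pat3 → Pat3 → Pat3 → Pat3 → ℤ}
    (h : ∀ eK e1 e2 PK QK P1 Q1 P2 Q2, X eK e1 e2 PK QK P1 Q1 P2 Q2 ≤ X' eK e1 e2 PK QK P1 Q1 P2 Q2) :
    tripleSum EK E₁ E₂ uK vK mK u₁ v₁ m₁ u₂ v₂ m₂ X ≤ tripleSum EK E₁ E₂ uK vK mK u₁ v₁ m₁ u₂ v₂ m₂ X' := by
  unfold tripleSum
  exact Finset.sum_le_sum fun _ _ => Finset.sum_le_sum fun _ _ => Finset.sum_le_sum fun _ _ => h ..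

/-- A term with nonnegative values has a nonnegative triple sum. [folklore] -/
theorem tripleSum_nonneg {X : ℕ → ℕ → ℕ → Pat3 → Pat3 → Pat3 → Pat3 → Pat3 → Pat3 → ℤ}
    (h : ∀ eK e1 e2 PK QK P1 Q1 P2 Q2, 0 ≤ X eK e1 e2 PK QK P1 Q1 P2 Q2) :
    0 ≤ tripleSum EK E₁ E₂ uK vK mK u₁ v₁ m₁ u₂ v₂ m₂ X := by
  unfold tripleSum
  exact Finset.sum_nonneg fun _ _ => Finset.sum_nonneg fun _ _ => Finset.sum_nonneg fun _ _ => h ..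

/-- The eightfold flip-symmetrisation of a term (pattern pairs of the pieces exchanged independently). [folklore] -/
def symm8 (X : ℕ → ℕ → ℕ → Pat3 → Pat3 → Pat3 → Pat3 → Pat3 → Pat3 → ℤ) :
    ℕ → ℕ → ℕ → Pat3 → Pat3 → Pat3 → Pat3 → Pat3 → Pat3 → ℤ :=
  fun eK e1 e2 PK QK P1 Q1 P2 Q2 =>
    X eK e1 e2 PK QK P1 Q1 P2 Q2 + X eK e1 e2 QK PK P1 Q1 P2 Q2 +
      (X eK e1 e2 PK QK Q1 P1 P2 Q2 + X eK e1 e2 QK PK Q1 P1 P2 Q2) +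
    (X eK e1 e2 PK QK P1 Q1 Q2 P2 + X eK e1 e2 QK PK P1 Q1 Q2 P2 +
      (X eK e1 e2 PK QK Q1 P1 Q2 P2 + X eK e1 e2 QK PK Q1 P1 Q2 P2))

/-- **Eight copies of a triple sum are the triple sum of the symmetrised term.** [folklore] -/
theorem tripleSum_symm8 (X : ℕ → ℕ → ℕ → Pat3 → Pat3 → Pat3 → Pat3 → Pat3 → Pat3 → ℤ) :
    8 * tripleSum EK E₁ E₂ uK vK mK u₁ v₁ m₁ u₂ v₂ m₂ X = tripleSum EK E₁ E₂ uK vK mK u₁ v₁ m₁ u₂ v₂ m₂ (symm8 X) := by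
  -- first piece
  set Y1 : ℕ → ℕ → ℕ → Pat3 → Pat3 → Pat3 → Pat3 → Pat3 → Pat3 → ℤ :=
    fun eK e1 e2 PK QK P1 Q1 P2 Q2 => X eK e1 e2 PK QK P1 Q1 P2 Q2 + X eK e1 e2 QK PK P1 Q1 P2 Q2 with hY1
  have h1 : tripleSum EK E₁ E₂ uK vK mK u₁ v₁ m₁ u₂ v₂ m₂ Y1 = 2 * tripleSum EK E₁ E₂ uK vK mK u₁ v₁ m₁ u₂ v₂ m₂ X := by
    rw [hY1, tripleSum_add, ← tripleSum_flipK]; ring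
  -- second piece
  set Y2 : ℕ → ℕ → ℕ → Pat3 → Pat3 → Pat3 → Pat3 → Pat3 → Pat3 → ℤ :=
    fun eK e1 e2 PK QK P1 Q1 P2 Q2 => Y1 eK e1 e2 PK QK P1 Q1 P2 Q2 + Y1 eK e1 e2 PK QK Q1 P1 P2 Q2 with hY2
  have h2 : tripleSum EK E₁ E₂ uK vK mK u₁ v₁ m₁ u₂ v₂ m₂ Y2 = 2 * tripleSum EK E₁ E₂ uK vK mK u₁ v₁ m₁ u₂ v₂ m₂ Y1 := by
    rw [hY2, tripleSum_add, ← tripleSum_flip1]; ring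
  -- third piece
  set Y3 : ℕ → ℕ → ℕ → Pat3 → Pat3 → Pat3 → Pat3 → Pat3 → Pat3 → ℤ :=
    fun eK e1 e2 PK QK P1 Q1 P2 Q2 => Y2 eK e1 e2 PK QK P1 Q1 P2 Q2 + Y2 eK e1 e2 PK QK P1 Q1 Q2 P2 with hY3
  have h3 : tripleSum EK E₁ E₂ uK vK mK u₁ v₁ m₁ u₂ v₂ m₂ Y3 = 2 * tripleSum EK E₁ E₂ uK vK mK u₁ v₁ m₁ u₂ v₂ m₂ Y2 := by
    rw [hY3, tripleSum_add, ← tripleSum_flip2]; ring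
  have hY : Y3 = symm8 X := by
    funext eK e1 e2 PK QK P1 Q1 P2 Q2
    simp only [hY3, hY2, hY1, symm8]
  rw [← hY, h3, h2, h1]; ring

/-- **The symmetrised target tensor**: `FK.target3` summed over the flip orbit of the cell. [folklore] -/
def target3Sym (join : Pat3 → Pat3 → Pat3 → Pat3) (corr : Pat3 → Pat3 → Pat3 → ℕ) (T : ℕ → Pat3 → Pat3 → ℤ) (d : ℕ)
    (PK QK P1 Q1 P2 Q2 : Pat3) : ℤ :=
  target3 join corr T d PK QK P1 Q1 P2 Q2 + target3 join corr T d QK PK P1 Q1 P2 Q2 +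
    (target3 join corr T d PK QK Q1 P1 P2 Q2 + target3 join corr T d QK PK Q1 P1 P2 Q2) +
  (target3 join corr T d PK QK P1 Q1 Q2 P2 + target3 join corr T d QK PK P1 Q1 Q2 P2 +
    (target3 join corr T d PK QK Q1 P1 Q2 P2 + target3 join corr T d QK PK Q1 P1 Q2 P2))

/-- With corrections `≤ 2` the symmetrised target has no entries at level offsets `≥ 6`. [folklore] -/
theorem target3Sym_eq_zero_of_le {join : Pat3 → Pat3 → Pat3 → Pat3} {corr : Pat3 → Pat3 → Pat3 → ℕ}
    (hcorr : ∀ P1 P2 P3, corr P1 P2 P3 ≤ 2) (T : ℕ → Pat3 → Pat3 → ℤ) {B d : ℕ} (hd : B + 6 ≤ d) (PK QK P1 Q1 P2 Q2 : Pat3) :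
    target3Sym join corr T d PK QK P1 Q1 P2 Q2 = 0 := by
  unfold target3Sym
  simp only [target3_eq_zero_of_le hcorr T hd, add_zero]

/-- The target-side term of `FK.lev2_decomp3` at the levels `e_K, e_1, e_2` (top level `N = λ + S`). [folklore] -/
def xterm (join : Pat3 → Pat3 → Pat3 → Pat3) (corr : Pat3 → Pat3 → Pat3 → ℕ) (T : ℕ → Pat3 → Pat3 → ℤ) (N : ℕ) :
    ℕ → ℕ → ℕ → Pat3 → Pat3 → Pat3 → Pat3 → Pat3 → Pat3 → ℤ :=
  fun eK e1 e2 PK QK P1 Q1 P2 Q2 =>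
    (if eK + e1 + e2 + corr PK P1 P2 + corr QK Q1 Q2 = N then T 0 (join PK P1 P2) (join QK Q1 Q2) else 0) +
      (if eK + e1 + e2 + corr PK P1 P2 + corr QK Q1 Q2 + 1 = N then T 1 (join PK P1 P2) (join QK Q1 Q2) else 0)

/-- The target-side term is the target tensor at the level offset `d = N − e`. [folklore] -/
theorem xterm_eq_target3 (join : Pat3 → Pat3 → Pat3 → Pat3) (corr : Pat3 → Pat3 → Pat3 → ℕ) (T : ℕ → Pat3 → Pat3 → ℤ)
    {N eK e1 e2 d : ℕ} (hd : eK + e1 + e2 + d = N) (PK QK P1 Q1 P2 Q2 : Pat3) :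
    xterm join corr T N eK e1 e2 PK QK P1 Q1 P2 Q2 = target3 join corr T d PK QK P1 Q1 P2 Q2 := by
  unfold xterm target3
  rw [Finset.sum_range_succ, Finset.sum_range_succ, Finset.sum_range_zero, zero_add]
  congr 1 <;> split_ifs <;> first | rfl | (exfalso; omega)

/-- Beyond the top level the target-side term vanishes. [folklore] -/
theorem xterm_eq_zero (join : Pat3 → Pat3 → Pat3 → Pat3) (corr : Pat3 → Pat3 → Pat3 → ℕ) (T : ℕ → Pat3 → Pat3 → ℤ)
    {N eK e1 e2 : ℕ} (hlt : N < eK + e1 + e2) (PK QK P1 Q1 P2 Q2 : Pat3) :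
    xterm join corr T N eK e1 e2 PK QK P1 Q1 P2 Q2 = 0 := by
  unfold xterm
  have h0 : ¬ (eK + e1 + e2 + corr PK P1 P2 + corr QK Q1 Q2 = N) := by omega
  have h1 : ¬ (eK + e1 + e2 + corr PK P1 P2 + corr QK Q1 Q2 + 1 = N) := by omega
  rw [if_neg h0, if_neg h1, add_zero]

/-- The product-side term of a product at the levels `e_K, e_1, e_2` (top level `N`). [folklore] -/
def bterm (p : Prod3) (N : ℕ) : ℕ → ℕ → ℕ → Pat3 → Pat3 → Pat3 → Pat3 → Pat3 → Pat3 → ℤ :=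
  fun eK e1 e2 PK QK P1 Q1 P2 Q2 =>
    ∑ cK ∈ Finset.range 2, ∑ c1 ∈ Finset.range 2, ∑ c2 ∈ Finset.range 2,
      (if eK + e1 + e2 + (cK + c1 + c2 + p.shift) = N then p.gK cK PK QK * p.g1 c1 P1 Q1 * p.g2 c2 P2 Q2 else 0)

/-- The product-side term is the product tensor at the level offset `d = N − e`. [folklore] -/
theorem bterm_eq_tensor (p : Prod3) {N eK e1 e2 d : ℕ} (hd : eK + e1 + e2 + d = N) (PK QK P1 Q1 P2 Q2 : Pat3) :
    bterm p N eK e1 e2 PK QK P1 Q1 P2 Q2 = p.tensor d PK QK P1 Q1 P2 Q2 := by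
  unfold bterm Prod3.tensor
  refine Finset.sum_congr rfl fun cK _ => Finset.sum_congr rfl fun c1 _ => Finset.sum_congr rfl fun c2 _ => ?_
  split_ifs <;> first | rfl | (exfalso; omega)

/-- Beyond the top level the product-side term vanishes. [folklore] -/
theorem bterm_eq_zero (p : Prod3) {N eK e1 e2 : ℕ} (hlt : N < eK + e1 + e2) (PK QK P1 Q1 P2 Q2 : Pat3) :
    bterm p N eK e1 e2 PK QK P1 Q1 P2 Q2 = 0 := by
  unfold bterm
  refine Finset.sum_eq_zero fun cK _ => Finset.sum_eq_zero fun c1 _ => Finset.sum_eq_zero fun c2 _ => ?_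
  have : ¬ (eK + e1 + e2 + (cK + c1 + c2 + p.shift) = N) := by omega
  rw [if_neg this]

/-- **The product side is nonnegative**: the triple sum of a product's term regroups, piece by piece (`FK.regroup1`), into
`Σ_{μ_K+μ_1+μ_2+κ = N} Π_p lev2 (piece_p) g_p μ_p ≥ 0`. [folklore] -/
theorem tripleSum_bterm_nonneg (p : Prod3) (N : ℕ)
    (hp : ∀ μ : ℕ, 0 ≤ lev2 EK uK vK mK p.gK μ ∧ 0 ≤ lev2 E₁ u₁ v₁ m₁ p.g1 μ ∧ 0 ≤ lev2 E₂ u₂ v₂ m₂ p.g2 μ) :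
    0 ≤ tripleSum EK E₁ E₂ uK vK mK u₁ v₁ m₁ u₂ v₂ m₂ (bterm p N) := by
  unfold tripleSum bterm
  -- piece 2
  have E01 : ∑ γK ∈ EK.powerset, ∑ γ₁ ∈ E₁.powerset, ∑ γ₂ ∈ E₂.powerset,
        ∑ cK ∈ Finset.range 2, ∑ c1 ∈ Finset.range 2, ∑ c2 ∈ Finset.range 2,
          (if apExp EK γK + apExp E₁ γ₁ + apExp E₂ γ₂ + (cK + c1 + c2 + p.shift) = N then
            p.gK cK (pat3 γK uK vK mK) (pat3 (EK \ γK) uK vK mK) * p.g1 c1 (pat3 γ₁ u₁ v₁ m₁) (pat3 (E₁ \ γ₁) u₁ v₁ m₁) *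
              p.g2 c2 (pat3 γ₂ u₂ v₂ m₂) (pat3 (E₂ \ γ₂) u₂ v₂ m₂) else 0) =
        ∑ γK ∈ EK.powerset, ∑ γ₁ ∈ E₁.powerset, ∑ cK ∈ Finset.range 2, ∑ c1 ∈ Finset.range 2,
          ∑ μ2 ∈ Finset.range (N + 1), (if μ2 + (apExp EK γK + cK + apExp E₁ γ₁ + c1 + p.shift) = N then
            lev2 E₂ u₂ v₂ m₂ p.g2 μ2 * (p.gK cK (pat3 γK uK vK mK) (pat3 (EK \ γK) uK vK mK) *
              p.g1 c1 (pat3 γ₁ u₁ v₁ m₁) (pat3 (E₁ \ γ₁) u₁ v₁ m₁)) else 0) := by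
    refine Finset.sum_congr rfl fun γK _ => Finset.sum_congr rfl fun γ₁ _ => ?_
    rw [Finset.sum_comm]
    refine Finset.sum_congr rfl fun cK _ => ?_
    rw [Finset.sum_comm]
    refine Finset.sum_congr rfl fun c1 _ => ?_
    rw [← regroup1 E₂ u₂ v₂ m₂ p.g2 N (apExp EK γK + cK + apExp E₁ γ₁ + c1 + p.shift)]
    refine Finset.sum_congr rfl fun γ₂ _ => Finset.sum_congr rfl fun c2 _ => ?_
    exact ite_eq_ite_of_iff (by constructor <;> intro h <;> omega) (by ring)
  -- piece 1
  have E12 : ∑ γK ∈ EK.powerset, ∑ γ₁ ∈ E₁.powerset, ∑ cK ∈ Finset.range 2, ∑ c1 ∈ Finset.range 2,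
        ∑ μ2 ∈ Finset.range (N + 1), (if μ2 + (apExp EK γK + cK + apExp E₁ γ₁ + c1 + p.shift) = N then
          lev2 E₂ u₂ v₂ m₂ p.g2 μ2 * (p.gK cK (pat3 γK uK vK mK) (pat3 (EK \ γK) uK vK mK) *
            p.g1 c1 (pat3 γ₁ u₁ v₁ m₁) (pat3 (E₁ \ γ₁) u₁ v₁ m₁)) else 0) =
      ∑ γK ∈ EK.powerset, ∑ cK ∈ Finset.range 2, ∑ μ2 ∈ Finset.range (N + 1), ∑ μ1 ∈ Finset.range (N + 1),
        (if μ1 + (apExp EK γK + cK + μ2 + p.shift) = N then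
          lev2 E₁ u₁ v₁ m₁ p.g1 μ1 * (lev2 E₂ u₂ v₂ m₂ p.g2 μ2 * p.gK cK (pat3 γK uK vK mK) (pat3 (EK \ γK) uK vK mK))
          else 0) := by
    refine Finset.sum_congr rfl fun γK _ => ?_
    rw [Finset.sum_comm]
    refine Finset.sum_congr rfl fun cK _ => ?_
    rw [Finset.sum_congr rfl fun γ₁ _ => Finset.sum_comm, Finset.sum_comm]
    refine Finset.sum_congr rfl fun μ2 _ => ?_
    rw [← regroup1 E₁ u₁ v₁ m₁ p.g1 N (apExp EK γK + cK + μ2 + p.shift)]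
    refine Finset.sum_congr rfl fun γ₁ _ => Finset.sum_congr rfl fun c1 _ => ?_
    exact ite_eq_ite_of_iff (by constructor <;> intro h <;> omega) (by ring)
  -- piece K
  have E23 : ∑ γK ∈ EK.powerset, ∑ cK ∈ Finset.range 2, ∑ μ2 ∈ Finset.range (N + 1), ∑ μ1 ∈ Finset.range (N + 1),
        (if μ1 + (apExp EK γK + cK + μ2 + p.shift) = N then
          lev2 E₁ u₁ v₁ m₁ p.g1 μ1 * (lev2 E₂ u₂ v₂ m₂ p.g2 μ2 * p.gK cK (pat3 γK uK vK mK) (pat3 (EK \ γK) uK vK mK))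
          else 0) =
      ∑ μ2 ∈ Finset.range (N + 1), ∑ μ1 ∈ Finset.range (N + 1), ∑ μK ∈ Finset.range (N + 1),
        (if μK + (μ1 + μ2 + p.shift) = N then
          lev2 EK uK vK mK p.gK μK * (lev2 E₁ u₁ v₁ m₁ p.g1 μ1 * lev2 E₂ u₂ v₂ m₂ p.g2 μ2) else 0) := by
    rw [Finset.sum_congr rfl fun γK _ => Finset.sum_comm]
    rw [Finset.sum_congr rfl fun γK _ => Finset.sum_congr rfl fun μ2 _ => Finset.sum_comm]
    rw [Finset.sum_comm]
    refine Finset.sum_congr rfl fun μ2 _ => ?_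
    rw [Finset.sum_comm]
    refine Finset.sum_congr rfl fun μ1 _ => ?_
    rw [← regroup1 EK uK vK mK p.gK N (μ1 + μ2 + p.shift)]
    refine Finset.sum_congr rfl fun γK _ => Finset.sum_congr rfl fun cK _ => ?_
    exact ite_eq_ite_of_iff (by constructor <;> intro h <;> omega) (by ring)
  rw [E01, E12, E23]
  refine Finset.sum_nonneg fun μ2 _ => Finset.sum_nonneg fun μ1 _ => Finset.sum_nonneg fun μK _ => ?_
  split_ifs
  · exact mul_nonneg (hp μK).1 (mul_nonneg (hp μ1).2.1 (hp μ2).2.2)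
  · exact le_rfl

variable {EK E₁ E₂ uK vK mK u₁ v₁ m₁ u₂ v₂ m₂}

/-- **SYMMETRISED PRODUCT-CONE LEMMA FOR A THREE-PIECE GLUING (census g34 PROOF-THEOREM-SP §2.2 in the form its certificates
actually have; kernel).**  As `FK.cone3_level_nonneg`, but the certificate need only dominate the target after summing over the
flip orbit of each cell: `8 · Σ_j λ_j π_j(d; cell) ≤ D · Σ_{g ∈ (ℤ/2)³} τ_T(d; g·cell)` (`FK.target3Sym`).  Proof: the trilinear
decomposition is re-indexed by `γ_p ↦ E_p ∖ γ_p` on each piece (levels kept by `FK.apExp_compl`, patterns exchanged), the eight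
copies are added (`FK.tripleSum_symm8`), and the flip-invariant product side is bounded below by zero as before.
[cite: AyyerLinussonRavichandran2025, §7 (p. 22)] -/
theorem cone3_level_nonneg_sym {G : Finset (Sym2 V)} {b s t : V}
    (join : Pat3 → Pat3 → Pat3 → Pat3) (corr : Pat3 → Pat3 → Pat3 → ℕ) (S : ℕ)
    (hdec : ∀ (w : ℕ → ℝ) (tab : Pat3 → Pat3 → ℤ),
      tval (fun n => w (n + S)) G b s t tab =
        ∑ γK ∈ EK.powerset, ∑ γ₁ ∈ E₁.powerset, ∑ γ₂ ∈ E₂.powerset,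
          w (apExp EK γK + apExp E₁ γ₁ + apExp E₂ γ₂ +
                corr (pat3 γK uK vK mK) (pat3 γ₁ u₁ v₁ m₁) (pat3 γ₂ u₂ v₂ m₂) +
              corr (pat3 (EK \ γK) uK vK mK) (pat3 (E₁ \ γ₁) u₁ v₁ m₁) (pat3 (E₂ \ γ₂) u₂ v₂ m₂)) *
            (tab (join (pat3 γK uK vK mK) (pat3 γ₁ u₁ v₁ m₁) (pat3 γ₂ u₂ v₂ m₂))
              (join (pat3 (EK \ γK) uK vK mK) (pat3 (E₁ \ γ₁) u₁ v₁ m₁) (pat3 (E₂ \ γ₂) u₂ v₂ m₂)) : ℝ))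
    (T : ℕ → Pat3 → Pat3 → ℤ) (D : ℕ) {ι : Type*} (J : Finset ι) (prod : ι → Prod3)
    (hcert : ∀ d : ℕ, ∀ PK QK P1 Q1 P2 Q2 : Pat3,
      8 * ∑ j ∈ J, ((prod j).lam : ℤ) * (prod j).tensor d PK QK P1 Q1 P2 Q2 ≤
        D * target3Sym join corr T d PK QK P1 Q1 P2 Q2)
    (hval : ∀ j ∈ J, ∀ μ : ℕ,
      0 ≤ lev2 EK uK vK mK (prod j).gK μ ∧ 0 ≤ lev2 E₁ u₁ v₁ m₁ (prod j).g1 μ ∧ 0 ≤ lev2 E₂ u₂ v₂ m₂ (prod j).g2 μ)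
    (lam0 : ℕ) : 0 ≤ (D : ℤ) * lev2 G b s t T lam0 := by
  set N := lam0 + S with hN
  -- Step 1: the decomposition, as a triple sum of the target-side term, symmetrised
  have e1 : lev2 G b s t T lam0 = tripleSum EK E₁ E₂ uK vK mK u₁ v₁ m₁ u₂ v₂ m₂ (xterm join corr T N) := by
    rw [lev2_decomp3 join corr S hdec T lam0]
    rfl
  have e8 : 8 * ((D : ℤ) * lev2 G b s t T lam0) =
      (D : ℤ) * tripleSum EK E₁ E₂ uK vK mK u₁ v₁ m₁ u₂ v₂ m₂ (symm8 (xterm join corr T N)) := by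
    rw [e1, ← tripleSum_symm8]; ring
  -- Step 2: termwise domination by the certificate
  have step2 : ∀ eK e1 e2 PK QK P1 Q1 P2 Q2,
      8 * ∑ j ∈ J, ((prod j).lam : ℤ) * bterm (prod j) N eK e1 e2 PK QK P1 Q1 P2 Q2 ≤
        (D : ℤ) * symm8 (xterm join corr T N) eK e1 e2 PK QK P1 Q1 P2 Q2 := by
    intro eK e1 e2 PK QK P1 Q1 P2 Q2
    by_cases hle : eK + e1 + e2 ≤ N
    · obtain ⟨d, hd⟩ := Nat.exists_eq_add_of_le hle
      have hd' : eK + e1 + e2 + d = N := hd.symm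
      have hx : symm8 (xterm join corr T N) eK e1 e2 PK QK P1 Q1 P2 Q2 = target3Sym join corr T d PK QK P1 Q1 P2 Q2 := by
        simp only [symm8, target3Sym, xterm_eq_target3 join corr T hd']
      rw [hx, Finset.sum_congr rfl fun j _ => by rw [bterm_eq_tensor (prod j) hd']]
      exact hcert d PK QK P1 Q1 P2 Q2
    · rw [not_le] at hle
      have hx : symm8 (xterm join corr T N) eK e1 e2 PK QK P1 Q1 P2 Q2 = 0 := by
        simp only [symm8, xterm_eq_zero join corr T hle, add_zero]
      rw [hx, mul_zero, Finset.sum_eq_zero fun j _ => by rw [bterm_eq_zero (prod j) hle, mul_zero], mul_zero]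
  -- Step 3: assemble
  have main : 0 ≤ 8 * ((D : ℤ) * lev2 G b s t T lam0) := by
    rw [e8, ← tripleSum_const_mul]
    refine le_trans ?_ (tripleSum_mono EK E₁ E₂ uK vK mK u₁ v₁ m₁ u₂ v₂ m₂ step2)
    rw [tripleSum_const_mul, tripleSum_finset_sum]
    refine mul_nonneg (by norm_num) (Finset.sum_nonneg fun j hj => ?_)
    rw [tripleSum_const_mul]
    exact mul_nonneg (Nat.cast_nonneg _) (tripleSum_bterm_nonneg EK E₁ E₂ uK vK mK u₁ v₁ m₁ u₂ v₂ m₂ (prod j) N (hval j hj))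
  linarith

end SymCone

end FK

end Summit.CriticalPhenomena.PercolationContinuityZ3.Theorems

end
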